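import Mathlib.RingTheory.MvPolynomial.Homogeneous
import Mathlib.RingTheory.MvPolynomial.WeightedHomogeneous
import Literature.Computability.AlgebraicComplexity.RazUniversalJoint
import Literature.Computability.AlgebraicComplexity.HomogeneousComponentsComplexity
import HarnessLib

/-!
# The universal circuit: ONE small polynomial `U(x, y)` whose specialisations `U(x, α)` are all
# polynomials of degree `≤ d` and circuit size `≤ s` (Raz 2010; Forbes–Shpilka–Volk 2018, Thm. 12)

Topic `Literature/Computability/AlgebraicComplexity`; continues `RazUniversalJoint.lean` (the
flattened universal circuit-graph `RazUniversal.jointOut R σ r N ∈ R[Z ⊕ Y]` for HOMOGENEOUS degree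
`r`, with its joint size bound). This file

* records the bi-degree of `jointOut`: it is weighted-homogeneous of degree `r` for the weight
  `1` on inputs / `0` on labels (`isWeightedHomogeneous_jointOut`; every monomial has `Z`-degree
  exactly `r`, `sum_inl_eq_of_mem_support_jointOut`) and has total degree `≤ 3r - 1`
  (`totalDegree_jointOut_le`);
* assembles the **universal circuit for degree `≤ d` and size `≤ s`** over ANY commutative
  semiring (`exists_universalCircuit`): the degree-`k` homogeneous component of a size-`s`
  polynomial costs `≤ (k+2)² s` (`complexity_homogeneousComponent_le_sq_mul`, BCS Lemma 21.25 —
  gate-by-gate homogenisation, no interpolation, hence no hypothesis on the semiring), so one copy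
  of `jointOut` per degree `k = 1, …, d` plus one parameter for the constant term covers every
  polynomial of degree `≤ d` and complexity `≤ s`; parameters `≤ 9376 (n+d+s+2)²⁶`, size
  `≤ 21877 (n+d+s+2)²⁶`, `Z`-degree `≤ d` per monomial, total degree `≤ 3d + 1`.

This is Forbes–Shpilka–Volk's Thm. 12 (ToC Thm. 3.1; Bürgisser 2000 §5.6, Raz 2010 Prop. 3.3)
WITHOUT the uniformity clause ("`U` can be constructed in time `poly(n,d,s)`", not expressible over
`complexity`); the named fact `Literature.Barriers.ValiantsHypothesis.FSV2018_thm12` follows in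
`Literature/Barriers/ValiantsHypothesis/FSV18UniversalConstructionsProofs.lean`.

Lean text of the assembly adapted from the cell `valiant-natproofs` files
`Summits/ValiantsHypothesis/ValiantsHypothesis/Theorems/BarrierLeverSuccinctHittingSetsForVPUniversalJoint.lean`
(`exists_jointGenerator`, over `ℂ`, regime `d = n`) and `…UniversalSize.lean` (`isHomogeneous_baseVal`).

## References

* [ForbesShpilkaVolk2018] M. A. Forbes, A. Shpilka, B. L. Volk, *Succinct hitting sets and barriers
  to proving lower bounds for algebraic circuits*, Theory Comput. 14 (2018), Thm. 12 (seq.) = ToC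
  Thm. 3.1 (p. 19).
* [Raz2010] R. Raz, *Elusive functions and lower bounds for arithmetic circuits*, Theory Comput. 6
  (2010), Prop. 2.8, Prop. 3.3.
* [BurgisserClausenShokrollahi1997] Lemma (21.25) (homogeneous parts of a computation).
-/

noncomputable section

namespace Literature.Computability.AlgebraicComplexity

open MvPolynomial

namespace RazUniversal

universe u v

variable {R : Type u} [CommSemiring R]

section JointDegree

variable {σ : Type v} [Fintype σ] {r N : ℕ}

/-! ### §2. The bi-degree of the joint output -/

omit [Fintype σ] in
/-- The total degree of a symbol is `≤ 1` over any commutative semiring. [folklore] -/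
private theorem totalDegree_X_le_one {Z : Type*} (v : Z) : (X v : MvPolynomial Z R).totalDegree ≤ 1 := by
  classical
  by_cases h1 : (1 : R) = 0
  · have h0 : (X v : MvPolynomial Z R) = 0 := by
      show monomial (Finsupp.single v 1) (1 : R) = 0
      rw [h1, monomial_zero]
    rw [h0, totalDegree_zero]
    exact Nat.zero_le _
  · haveI : Nontrivial R := nontrivial_of_ne 1 0 h1
    rw [totalDegree_X]

variable (σ r N) in
/-- The input/label weight: inputs `Z` weigh `1`, labels `Y` weigh `0`.
[cite: Raz2010, Prop. 2.8 (p. 154)] -/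
def inputWeight : σ ⊕ Lab σ r N → ℕ := Sum.elim (fun _ => 1) (fun _ => 0)

omit [Fintype σ] in
/-- Unfolding the input weight on an input. [folklore] -/
@[simp] private theorem inputWeight_inl (t : σ) : inputWeight σ r N (Sum.inl t) = 1 := rfl

omit [Fintype σ] in
/-- Unfolding the input weight on a label. [folklore] -/
@[simp] private theorem inputWeight_inr (l : Lab σ r N) : inputWeight σ r N (Sum.inr l) = 0 := rfl

/-- **Level-`d` nodes are homogeneous of degree `d` in the inputs** (labels weigh `0`).
[cite: Raz2010, Prop. 2.8 (p. 154)] -/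
theorem isWeightedHomogeneous_jointBase :
    ∀ (n : ℕ) (d : Fin (r + 1)), (d : ℕ) = n → ∀ b : BIdx σ r N,
      IsWeightedHomogeneous (inputWeight σ r N) (jointBase (R := R) d b) n := by
  -- adapted from Summits/…/BarrierLeverSuccinctHittingSetsForVPUniversalSize.lean (isHomogeneous_baseVal)
  intro n
  induction n using Nat.strong_induction_on with
  | _ n ih =>
    intro d hd b
    rcases b with t | ⟨j, k⟩
    · rw [jointBase_inl]
      split_ifs with h1
      · have h := isWeightedHomogeneous_X R (inputWeight σ r N) (Sum.inl t : σ ⊕ Lab σ r N)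
        rw [inputWeight_inl] at h
        rw [← hd, h1]
        exact h
      · exact isWeightedHomogeneous_zero R _ n
    · by_cases h : 1 ≤ (j : ℕ) ∧ (j : ℕ) < (d : ℕ)
      · rw [jointBase_inr d j k h]
        have h1 : IsWeightedHomogeneous (inputWeight σ r N)
            (∑ b : BIdx σ r N, X (Sum.inr (Sum.inl (d, j, k, false, b))) *
              jointBase (R := R) (Fin.castSucc j) b) (j : ℕ) := by
          refine IsWeightedHomogeneous.sum _ _ _ fun b _ => ?_
          have hb := (isWeightedHomogeneous_X R (inputWeight σ r N)
            (Sum.inr (Sum.inl (d, j, k, false, b)) : σ ⊕ Lab σ r N)).mul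
            (ih j (by omega) (Fin.castSucc j) (by simp) b)
          simpa using hb
        have h2 : IsWeightedHomogeneous (inputWeight σ r N)
            (∑ b : BIdx σ r N, X (Sum.inr (Sum.inl (d, j, k, true, b))) *
              jointBase (R := R) ⟨(d : ℕ) - j, by have := d.isLt; omega⟩ b) ((d : ℕ) - j) := by
          refine IsWeightedHomogeneous.sum _ _ _ fun b _ => ?_
          have hb := (isWeightedHomogeneous_X R (inputWeight σ r N)
            (Sum.inr (Sum.inl (d, j, k, true, b)) : σ ⊕ Lab σ r N)).mul
            (ih ((d : ℕ) - j) (by omega) ⟨(d : ℕ) - j, by have := d.isLt; omega⟩ rfl b)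
          simpa using hb
        have := h1.mul h2
        rwa [show (j : ℕ) + ((d : ℕ) - j) = n by omega] at this
      · rw [jointBase_inr_of_not d j k h]
        exact isWeightedHomogeneous_zero R _ n

/-- **`OUT` is homogeneous of degree `r` in the inputs.** [cite: Raz2010, Prop. 2.8 (p. 154)] -/
theorem isWeightedHomogeneous_jointOut :
    IsWeightedHomogeneous (inputWeight σ r N) (jointOut R σ r N) r := by
  rw [jointOut_eq]
  refine IsWeightedHomogeneous.sum _ _ _ fun b _ => ?_
  have hb := (isWeightedHomogeneous_X R (inputWeight σ r N)
    (Sum.inr (Sum.inr b) : σ ⊕ Lab σ r N)).mul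
    (isWeightedHomogeneous_jointBase (R := R) r (Fin.last r) (by simp) b)
  simpa using hb

/-- The input weight of an exponent vector is its total degree in the input variables.
[folklore] -/
private theorem weight_inputWeight_eq (e : σ ⊕ Lab σ r N →₀ ℕ) :
    Finsupp.weight (inputWeight σ r N) e = ∑ t : σ, e (Sum.inl t) := by
  classical
  rw [Finsupp.weight_apply, Finsupp.sum_fintype _ _ (fun _ => by simp)]
  rw [Fintype.sum_sum_type]
  simp

/-- Every monomial of `OUT` has degree exactly `r` in the inputs.
[cite: Raz2010, Prop. 2.8 (p. 154)] -/
theorem sum_inl_eq_of_mem_support_jointOut {e : σ ⊕ Lab σ r N →₀ ℕ}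
    (he : e ∈ (jointOut R σ r N).support) : ∑ t : σ, e (Sum.inl t) = r := by
  rw [← weight_inputWeight_eq]
  exact isWeightedHomogeneous_jointOut (R := R) (mem_support_iff.mp he)

/-- **Total degree of the nodes**: a level-`d` node has total degree `≤ 3d - 2` (inputs and
labels together; each product slot adds two label factors). [cite: Raz2010, Prop. 2.8 (p. 154)] -/
theorem totalDegree_jointBase_le :
    ∀ (n : ℕ) (d : Fin (r + 1)), (d : ℕ) = n → ∀ b : BIdx σ r N,
      (jointBase (R := R) d b).totalDegree ≤ 3 * n - 2 := by
  intro n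
  induction n using Nat.strong_induction_on with
  | _ n ih =>
    intro d hd b
    rcases b with t | ⟨j, k⟩
    · rw [jointBase_inl]
      split_ifs with h1
      · refine (totalDegree_X_le_one _).trans ?_
        omega
      · rw [totalDegree_zero]; exact Nat.zero_le _
    · by_cases h : 1 ≤ (j : ℕ) ∧ (j : ℕ) < (d : ℕ)
      · rw [jointBase_inr d j k h]
        have h1 : (∑ b : BIdx σ r N, X (Sum.inr (Sum.inl (d, j, k, false, b))) *
              jointBase (R := R) (Fin.castSucc j) b).totalDegree ≤ 1 + (3 * (j : ℕ) - 2) := by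
          refine totalDegree_finsetSum_le fun b _ => (totalDegree_mul _ _).trans ?_
          exact Nat.add_le_add (totalDegree_X_le_one _) (ih j (by omega) (Fin.castSucc j) (by simp) b)
        have h2 : (∑ b : BIdx σ r N, X (Sum.inr (Sum.inl (d, j, k, true, b))) *
              jointBase (R := R) ⟨(d : ℕ) - j, by have := d.isLt; omega⟩ b).totalDegree ≤
              1 + (3 * ((d : ℕ) - j) - 2) := by
          refine totalDegree_finsetSum_le fun b _ => (totalDegree_mul _ _).trans ?_
          exact Nat.add_le_add (totalDegree_X_le_one _)
            (ih ((d : ℕ) - j) (by omega) ⟨(d : ℕ) - j, by have := d.isLt; omega⟩ rfl b)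
        refine (totalDegree_mul _ _).trans ((Nat.add_le_add h1 h2).trans ?_)
        omega
      · rw [jointBase_inr_of_not d j k h, totalDegree_zero]; exact Nat.zero_le _

/-- **`OUT` has total degree `≤ 3r - 1`** (so each monomial has label-degree `< 3r`).
[cite: Raz2010, Prop. 2.8 (p. 154)] -/
theorem totalDegree_jointOut_le : (jointOut R σ r N).totalDegree ≤ 3 * r - 1 := by
  rw [jointOut_eq]
  rcases Nat.eq_zero_or_pos r with hr0 | hr1
  · subst hr0
    refine totalDegree_finsetSum_le fun b _ => ?_
    rcases b with t | ⟨j, _⟩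
    · rw [jointBase_inl]; simp
    · exact j.elim0
  · refine totalDegree_finsetSum_le fun b _ => (totalDegree_mul _ _).trans ?_
    have := Nat.add_le_add (totalDegree_X_le_one (R := R) (Sum.inr (Sum.inr b) : σ ⊕ Lab σ r N))
      (totalDegree_jointBase_le (R := R) r (Fin.last r) (by simp) b)
    omega

end JointDegree

/-! ### §3. The universal circuit for degree `≤ d` and size `≤ s` -/

section Universal

/-- Arithmetic for the universal circuit: with `T = n + d + s + 2`, the slot count
`W = 4 (d+2)² s (d+1)²` is `≤ 4 T⁵` and `n + (k+1) + W + 1 ≤ 5 T⁵` for `k < d`. [folklore] -/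
private theorem universal_aux_le {n s d k : ℕ} (hk : k < d) :
    n + (k + 1) + 4 * ((d + 2) ^ 2 * s) * (d + 1) ^ 2 + 1 ≤ 5 * (n + d + s + 2) ^ 5 := by
  set T := n + d + s + 2 with hT
  have h1 : 1 ≤ T := by omega
  have hd2 : d + 2 ≤ T := by omega
  have hd1 : d + 1 ≤ T := by omega
  have hs : s ≤ T := by omega
  have hW : 4 * ((d + 2) ^ 2 * s) * (d + 1) ^ 2 ≤ 4 * T ^ 5 := by
    calc 4 * ((d + 2) ^ 2 * s) * (d + 1) ^ 2 ≤ 4 * (T ^ 2 * T) * T ^ 2 := by gcongr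
      _ = 4 * T ^ 5 := by ring
  have hT5 : T ≤ T ^ 5 := Nat.le_self_pow (by norm_num) T
  have hnk : n + (k + 1) + 1 ≤ T := by omega
  omega

variable (R : Type u) [CommSemiring R]

/-- **The universal circuit (Raz 2010; Forbes–Shpilka–Volk 2018, Thm. 12), over any commutative
semiring.** For all `n, s, d` there are `p ≤ 9376 (n+d+s+2)²⁶` parameters and ONE polynomial
`U ∈ R[x₁,…,x_n, y₁,…,y_p]` of circuit size `≤ 21877 (n+d+s+2)²⁶`, every monomial of which has
degree `≤ d` in the `x`-variables, of total degree `≤ 3d + 1`, such that every `f ∈ R[x₁,…,x_n]` of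
total degree `≤ d` and complexity `≤ s` is a specialisation `f = U(x, α)` of the `y`-variables to
constants. Construction: `U = y₀ + Σ_{k=1}^{d} OUT_k(x, y_k)` with one copy of Raz's flattened
universal circuit-graph `jointOut R (Fin n) k W`, `W = 4 (d+2)² s (d+1)²`, per degree `k`; the
degree-`k` homogeneous component of `f` has complexity `≤ (k+2)² s` (BCS Lemma 21.25) and is
therefore some `OUT_k(x, y_k)` (`RazUniversal.exists_labels_of_complexity_le`). The printed
uniformity clause ("constructible in time `poly(n,d,s)`") is not formalised.
[cite: ForbesShpilkaVolk2018, Thm. 12 (seq.) = ToC Thm. 3.1; Raz2010, Prop. 3.3 (p. 158)] -/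
theorem exists_universalCircuit (n s d : ℕ) :
    ∃ (p : ℕ) (U : MvPolynomial (Fin n ⊕ Fin p) R),
      p ≤ 9376 * (n + d + s + 2) ^ 26 ∧
      complexity U ≤ 21877 * (n + d + s + 2) ^ 26 ∧
      (∀ e ∈ U.support, ∑ i : Fin n, e (Sum.inl i) ≤ d) ∧
      U.totalDegree ≤ 3 * d + 1 ∧
      ∀ f : MvPolynomial (Fin n) R, f.totalDegree ≤ d → complexity f ≤ s →
        ∃ α : Fin p → R, aeval (Sum.elim X fun j => C (α j)) U = f := by
  -- adapted from Summits/…/BarrierLeverSuccinctHittingSetsForVPUniversalJoint.lean (exists_jointGenerator)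
  classical
  set s' := (d + 2) ^ 2 * s with hs'
  set W := 4 * s' * (d + 1) ^ 2 with hW
  obtain ⟨T, hT⟩ : ∃ T, n + d + s + 2 = T := ⟨_, rfl⟩
  rw [hT]
  let L : Fin d → Type := fun k => Lab (Fin n) ((k : ℕ) + 1) W
  let P := Unit ⊕ (Σ k : Fin d, L k)
  let e := Fintype.equivFin P
  let ι : ∀ k : Fin d, Fin n ⊕ L k → Fin n ⊕ Fin (Fintype.card P) := fun k =>
    Sum.map id fun l => e (Sum.inr ⟨k, l⟩)
  have hinj : ∀ k, Function.Injective (ι k) := fun k =>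
    Sum.map_injective.2 ⟨fun _ _ h => h,
      fun a b h => sigma_mk_injective (Sum.inr_injective (e.injective h))⟩
  let J : Fin d → MvPolynomial (Fin n ⊕ Fin (Fintype.card P)) R := fun k =>
    rename (ι k) (jointOut R (Fin n) ((k : ℕ) + 1) W)
  let U : MvPolynomial (Fin n ⊕ Fin (Fintype.card P)) R := X (Sum.inr (e (Sum.inl ()))) + ∑ k, J k
  have h1T : 1 ≤ T := by omega
  have hT26 : 1 ≤ T ^ 26 := Nat.one_le_pow _ _ h1T
  have hdT : d ≤ T := by omega
  -- the polynomial bounds per level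
  have hlvl : ∀ k : Fin d, n + ((k : ℕ) + 1) + W + 1 ≤ 5 * T ^ 5 := fun k => by
    rw [hW, hs', ← hT]; exact universal_aux_le k.isLt
  have hpow : ∀ k : Fin d, (n + ((k : ℕ) + 1) + W + 1) ^ 5 ≤ 3125 * T ^ 25 := fun k => by
    calc (n + ((k : ℕ) + 1) + W + 1) ^ 5 ≤ (5 * T ^ 5) ^ 5 := Nat.pow_le_pow_left (hlvl k) 5
      _ = 3125 * T ^ 25 := by ring
  refine ⟨Fintype.card P, U, ?_, ?_, ?_, ?_, ?_⟩
  · -- parameter count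
    have hP : Fintype.card P = 1 + ∑ k : Fin d, Fintype.card (L k) := by
      simp [P, Fintype.card_sum, Fintype.card_sigma]
    rw [hP]
    have hL : ∀ k : Fin d, Fintype.card (L k) ≤ 9375 * T ^ 25 := fun k => by
      calc Fintype.card (L k) ≤ 3 * (Fintype.card (Fin n) + ((k : ℕ) + 1) + W + 1) ^ 5 :=
            card_lab_le (Fin n) _ W
        _ = 3 * (n + ((k : ℕ) + 1) + W + 1) ^ 5 := by rw [Fintype.card_fin]
        _ ≤ 3 * (3125 * T ^ 25) := Nat.mul_le_mul_left 3 (hpow k)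
        _ = 9375 * T ^ 25 := by ring
    calc 1 + ∑ k : Fin d, Fintype.card (L k) ≤ 1 + ∑ _k : Fin d, 9375 * T ^ 25 := by
          gcongr with k; exact hL k
      _ = 1 + d * (9375 * T ^ 25) := by simp
      _ ≤ T ^ 26 + T * (9375 * T ^ 25) := by gcongr
      _ = 9376 * T ^ 26 := by ring
  · -- size
    have hJc : ∀ k : Fin d, complexity (J k) ≤ 21875 * T ^ 25 := fun k => by
      calc complexity (J k) ≤ complexity (jointOut R (Fin n) ((k : ℕ) + 1) W) :=
            complexity_rename_le_holds' _ _
        _ ≤ 7 * (n + ((k : ℕ) + 1) + W + 1) ^ 5 := complexity_jointOut_le_poly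
        _ ≤ 7 * (3125 * T ^ 25) := Nat.mul_le_mul_left 7 (hpow k)
        _ = 21875 * T ^ 25 := by ring
    calc complexity U
        ≤ complexity (X (Sum.inr (e (Sum.inl ()))) : MvPolynomial (Fin n ⊕ Fin (Fintype.card P)) R) +
            complexity (∑ k, J k) + 1 := complexity_add_le_holds _ _
      _ ≤ 0 + (∑ k, complexity (J k) + (Finset.univ : Finset (Fin d)).card) + 1 := by
          rw [complexity_X_holds]
          gcongr
          exact complexity_finset_sum_le _ _
      _ ≤ 0 + (∑ _k : Fin d, 21875 * T ^ 25 + (Finset.univ : Finset (Fin d)).card) + 1 := by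
          gcongr with k; exact hJc k
      _ = d * (21875 * T ^ 25) + d + 1 := by simp
      _ ≤ T * (21875 * T ^ 25) + T ^ 26 + T ^ 26 := by gcongr; exact hdT.trans (Nat.le_self_pow (by norm_num) T)
      _ = 21877 * T ^ 26 := by ring
  · -- degree in the inputs
    intro ex hex
    rcases Finset.mem_union.mp (support_add hex) with h1 | h1
    · change ex ∈ (monomial (Finsupp.single (Sum.inr (e (Sum.inl ()))) 1) (1 : R)).support at h1
      have hex1 := Finset.mem_singleton.mp (support_monomial_subset h1)
      subst hex1
      simp
    · obtain ⟨k, -, hk⟩ := Finset.mem_biUnion.mp (support_sum h1)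
      simp only [J] at hk
      rw [support_rename_of_injective (hinj k)] at hk
      obtain ⟨e', he', rfl⟩ := Finset.mem_image.mp hk
      have hsum := sum_inl_eq_of_mem_support_jointOut (R := R) he'
      calc ∑ i : Fin n, Finsupp.mapDomain (ι k) e' (Sum.inl i) = ∑ i : Fin n, e' (Sum.inl i) := by
            refine Finset.sum_congr rfl fun i _ => ?_
            have : (Sum.inl i : Fin n ⊕ Fin (Fintype.card P)) = ι k (Sum.inl i) := rfl
            rw [this, Finsupp.mapDomain_apply (hinj k)]
        _ = (k : ℕ) + 1 := hsum
        _ ≤ d := k.isLt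
  · -- total degree
    refine (totalDegree_add _ _).trans (max_le ((totalDegree_X_le_one _).trans (by omega)) ?_)
    refine totalDegree_finsetSum_le fun k _ => (totalDegree_rename_le _ _).trans ?_
    refine (totalDegree_jointOut_le (R := R) (σ := Fin n) (r := (k : ℕ) + 1) (N := W)).trans ?_
    have := k.isLt
    omega
  · -- universality
    intro f hfd hfs
    have hlab : ∀ k : Fin d, ∃ y : L k → R, outVal y = homogeneousComponent ((k : ℕ) + 1) f := by
      intro k
      have hk1 : 1 ≤ (k : ℕ) + 1 := by omega
      have hg : (homogeneousComponent ((k : ℕ) + 1) f).IsHomogeneous ((k : ℕ) + 1) :=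
        homogeneousComponent_isHomogeneous _ _
      have hgc : complexity (homogeneousComponent ((k : ℕ) + 1) f) ≤ s' := by
        refine (complexity_homogeneousComponent_le_sq_mul f _).trans ?_
        rw [hs']
        have hk2 : ((k : ℕ) + 1 + 2) ^ 2 ≤ (d + 2) ^ 2 :=
          Nat.pow_le_pow_left (by have := k.isLt; omega) 2
        exact Nat.mul_le_mul hk2 hfs
      have hN : 4 * s' * ((k : ℕ) + 1 + 1) ^ 2 ≤ W := by
        rw [hW]
        have hk2 : (k : ℕ) + 1 + 1 ≤ d + 1 := by have := k.isLt; omega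
        exact Nat.mul_le_mul_left _ (Nat.pow_le_pow_left hk2 2)
      exact exists_labels_of_complexity_le (R := R) (σ := Fin n) (r := (k : ℕ) + 1) (N := W)
        hk1 hN hg hgc
    choose y hy using hlab
    let Y : P → R := Sum.elim (fun _ => coeff 0 f) (fun kl => y kl.1 kl.2)
    refine ⟨Y ∘ e.symm, ?_⟩
    have hJ : ∀ k, aeval (Sum.elim X fun j => C ((Y ∘ e.symm) j)) (J k) =
        homogeneousComponent ((k : ℕ) + 1) f := by
      intro k
      simp only [J]
      rw [aeval_rename]
      have hfun : ((Sum.elim X fun j => C ((Y ∘ e.symm) j)) ∘ ι k :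
          Fin n ⊕ L k → MvPolynomial (Fin n) R) = Sum.elim X fun l => C (y k l) := by
        funext v
        rcases v with t | l
        · rfl
        · simp [ι, Y]
      rw [hfun, aeval_labels_jointOut, hy]
    have hspec : aeval (Sum.elim X fun j => C ((Y ∘ e.symm) j)) U =
        C (coeff 0 f) + ∑ k : Fin d, homogeneousComponent ((k : ℕ) + 1) f := by
      simp only [U]
      rw [map_add, map_sum, aeval_X]
      congr 1
      · simp [Y]
      · exact Finset.sum_congr rfl fun k _ => hJ k
    rw [hspec, ← homogeneousComponent_zero]
    have hsub : Finset.range (f.totalDegree + 1) ⊆ Finset.range (d + 1) :=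
      Finset.range_subset_range.mpr (by omega)
    calc homogeneousComponent 0 f + ∑ k : Fin d, homogeneousComponent ((k : ℕ) + 1) f
        = ∑ i ∈ Finset.range (d + 1), homogeneousComponent i f := by
          rw [Finset.sum_range_succ', Finset.sum_range]
          exact add_comm _ _
      _ = ∑ i ∈ Finset.range (f.totalDegree + 1), homogeneousComponent i f := by
          refine (Finset.sum_subset hsub fun i _ hi' => ?_).symm
          apply homogeneousComponent_eq_zero
          simp only [Finset.mem_range] at hi'
          omega
      _ = f := sum_homogeneousComponent f

end Universal

end RazUniversal

end Literature.Computability.AlgebraicComplexity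

end
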